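import Summits.ResolutionOfSingularities.ResolutionOfSingularities.Theses.FrobeniusLadder
import Literature.RingTheory.TightClosure.TightClosure

/-!
# Sketch — crux-ideate round 1, ideator 1, crux `FRationalResolution` (stmt-ResolutionOfSingularities-15317)

First lemmas (as elaborating signatures) for the two idea cards filed from this folder:

* §1 card `hk-datum-tame-on-f-rational` — Hilbert–Kunz lengths / multiplicity as a resolution datum
  on the F-rational class: `hkLength`, `HasHKMultiplicity`, `HKRegularityOnFRational` (WY00/HY02 shape
  restricted to the crux's class), `HKFaithfulOnFRational` (Hochster–Yao F-rational signature
  positivity shape: HK lengths separate a parameter ideal from any strictly larger ideal).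
* §2 card `test-ideal-rung-to-f-regular` — the inserted rung: `WeaklyFRegularModification`,
  `WeaklyFRegularResolution` and the pure-logic composition `fRationalResolution_of_rungs` onto the
  crux decl BY NAME.
* §3 calibration (negative note `suspension-calibration`): `hyperbolicSuspension` — the extended Rees
  algebra `k[x][f t, t⁻¹] ≅ k[x,y,z]/(yz + f)`; only the object is typed here.
-/

namespace Summit.ResolutionOfSingularities.ResolutionOfSingularities.Cruxes.FRationalResolution.Sketch

open Literature.RingTheory.TightClosure Literature.AlgebraicGeometry.Resolution IsLocalRing

/-! ## §1 Hilbert–Kunz data (card `hk-datum-tame-on-f-rational`) -/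

/-- The level-`e` Hilbert–Kunz (Kunz) length `ℓ_R(R/𝔪^{[p^e]})` of a local ring, as a natural number
(`⊤ ↦ 0`; finite for Noetherian local `R`). Defined for EVERY local ring of characteristic `p` —
no F-finiteness, no perfectness of a ground field. -/
noncomputable def hkLength (p : ℕ) (R : Type*) [CommRing R] [IsLocalRing R] (e : ℕ) : ℕ :=
  (Module.length R (R ⧸ frobeniusPower (p ^ e) (maximalIdeal R))).toNat

/-- `R` (local, of dimension `d`) has Hilbert–Kunz multiplicity `L`:
`ℓ(R/𝔪^{[p^e]}) / p^{e d} → L` (Monsky 1983: the limit exists for Noetherian local rings). -/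
def HasHKMultiplicity (p : ℕ) (R : Type*) [CommRing R] [IsLocalRing R] (d : ℕ) (L : ℝ) : Prop :=
  Filter.Tendsto (fun e : ℕ => (hkLength p R e : ℝ) / (p : ℝ) ^ (e * d)) Filter.atTop (nhds L)

/-- FIRST LEMMA (card 1, named-fact shape to vendor/prove): on the crux's class — F-rational
Noetherian local DOMAINS of characteristic `p` (excellent in every use: stalks of finite-type
`k`-schemes) — the Hilbert–Kunz multiplicity is `1` exactly at the regular points
(Watanabe–Yoshida 2000 / Huneke–Yao 2002, "formally unmixed"; F-rational excellent local rings are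
normal, hence analytically irreducible, hence unmixed). This is what makes `e_HK = 1` the terminal
value of the datum. -/
def HKRegularityOnFRational : Prop :=
  ∀ (p : ℕ) [Fact p.Prime] (R : Type) [CommRing R] [IsDomain R] [IsNoetherianRing R] [IsLocalRing R]
    [CharP R p], IsFRational R p → ∀ d : ℕ, ringKrullDim R = d →
      (HasHKMultiplicity p R d 1 ↔ IsRegularLocalRing R)

/-- FIRST LEMMA (card 1, the F-rational-specific faithfulness, Hochster–Yao "F-rational signature is
positive" shape): in an F-rational local domain, for every system of parameters `s` and every
`y ∉ (s)`, the Kunz colengths of `(s)` and `(s) + (y)` differ by at least `δ · p^{e d}` for a fixed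
`δ > 0` — HK data SEPARATE a parameter ideal from every strictly larger ideal (Hochster–Huneke 1990
Thm 8.17 length criterion + `(s)* = (s)`). This is the property that fails off the F-rational class
and is the engine of Smirnov's HK-equimultiplicity criteria. -/
def HKFaithfulOnFRational : Prop :=
  ∀ (p : ℕ) [Fact p.Prime] (R : Type) [CommRing R] [IsDomain R] [IsNoetherianRing R] [IsLocalRing R]
    [CharP R p], IsFRational R p → ∀ d : ℕ, ringKrullDim R = d → ∀ s : Fin d → R,
      IsSystemOfParameters s → ∀ y : R, y ∉ Ideal.span (Set.range s) →
        ∃ δ : ℝ, 0 < δ ∧ ∀ e : ℕ,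
          δ * (p : ℝ) ^ (e * d) ≤
            ((Module.length R (R ⧸ frobeniusPower (p ^ e) (Ideal.span (Set.range s)))).toNat : ℝ) -
              ((Module.length R
                (R ⧸ frobeniusPower (p ^ e) (Ideal.span (Set.range s) ⊔ Ideal.span {y}))).toNat : ℝ)

/-! ## §2 The inserted rung (card `test-ideal-rung-to-f-regular`) -/

/-- The finitistic test ideal `τ_fg(R) = ⋂_I (I : I^*)` — the uniform annihilator of all tight-closure
relations (Hochster–Huneke); its cosupport is the non-weakly-F-regular locus. The card's engine
blows up ideals built from it (Kawasaki-style), as the route's rung 3 does with parameter test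
elements. -/
def finitisticTestIdeal (p : ℕ) (R : Type*) [CommRing R] [ExpChar R p] : Ideal R :=
  ⨅ I : Ideal R, Submodule.colon I (tightClosure p I : Set R)

/-- Hypothesis shape "X admits a proper birational F-rational locally-integral model" — VERBATIM the
antecedent of the crux `FrobeniusLadder.FRationalResolution`. -/
def HasFRationalModel (p : ℕ) (X : AlgebraicGeometry.Scheme.{0}) : Prop :=
  ∃ (X' : AlgebraicGeometry.Scheme.{0}) (π : X' ⟶ X), AlgebraicGeometry.IsProper π ∧
    Literature.AlgebraicGeometry.Resolution.IsBirational π ∧ ∀ x : X', IsDomain (X'.presheaf.stalk x) ∧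
    ∀ d : ℕ, ringKrullDim (X'.presheaf.stalk x) = d → ∀ s : Fin d → X'.presheaf.stalk x,
    (Ideal.span (Set.range s)).radical.IsMaximal → ∀ y c : X'.presheaf.stalk x, c ≠ 0 →
    (∀ e : ℕ, c * y ^ p ^ e ∈ Ideal.span ((fun z : X'.presheaf.stalk x => z ^ p ^ e) ''
      (Ideal.span (Set.range s) : Set (X'.presheaf.stalk x)))) → y ∈ Ideal.span (Set.range s)

/-- Hypothesis shape "X admits a proper birational WEAKLY F-REGULAR locally-integral model": every
stalk is a domain in which EVERY ideal is tightly closed (domain form: `c ≠ 0`,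
`c y^q ∈ I^{[q]}` for all `q` ⇒ `y ∈ I`). One rung above F-rational ("parameter ideals tightly
closed"), one below regular ("every ideal tightly closed + Kunz"). -/
def HasWeaklyFRegularModel (p : ℕ) (X : AlgebraicGeometry.Scheme.{0}) : Prop :=
  ∃ (X' : AlgebraicGeometry.Scheme.{0}) (π : X' ⟶ X), AlgebraicGeometry.IsProper π ∧
    Literature.AlgebraicGeometry.Resolution.IsBirational π ∧ ∀ x : X', IsDomain (X'.presheaf.stalk x) ∧
    ∀ I : Ideal (X'.presheaf.stalk x), ∀ y c : X'.presheaf.stalk x, c ≠ 0 →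
    (∀ e : ℕ, c * y ^ p ^ e ∈ Ideal.span ((fun z : X'.presheaf.stalk x => z ^ p ^ e) ''
      (I : Set (X'.presheaf.stalk x)))) → y ∈ I

/-- RUNG 3½ (card 2, crux-sized): F-REGULARIZATION OF F-RATIONAL VARIETIES. For every prime `p`, field
`k` of characteristic `p` and reduced separated finite-type `X/k`: an F-rational proper birational
model gives a weakly F-regular proper birational model. -/
def WeaklyFRegularModification : Prop :=
  ∀ p : ℕ, p.Prime → ∀ (k : Type) [Field k] [CharP k p] (X : AlgebraicGeometry.Scheme.{0})
    (f : X ⟶ AlgebraicGeometry.Spec (.of k)), AlgebraicGeometry.IsSeparated f →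
    AlgebraicGeometry.LocallyOfFiniteType f → AlgebraicGeometry.QuasiCompact f →
    AlgebraicGeometry.IsReduced X → HasFRationalModel p X → HasWeaklyFRegularModel p X

/-- RUNG 4′ (card 2, the residual): RESOLUTION OF WEAKLY F-REGULAR VARIETIES. -/
def WeaklyFRegularResolution : Prop :=
  ∀ p : ℕ, p.Prime → ∀ (k : Type) [Field k] [CharP k p] (X : AlgebraicGeometry.Scheme.{0})
    (f : X ⟶ AlgebraicGeometry.Spec (.of k)), AlgebraicGeometry.IsSeparated f →
    AlgebraicGeometry.LocallyOfFiniteType f → AlgebraicGeometry.QuasiCompact f →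
    AlgebraicGeometry.IsReduced X → HasWeaklyFRegularModel p X →
    Literature.AlgebraicGeometry.Resolution.Scheme.HasResolution X

/-- TRANSFER GLUE (card 2): the two inserted rungs compose to the crux BY NAME (pure logic; the crux's
antecedent is literally `HasFRationalModel p X`). -/
theorem fRationalResolution_of_rungs (h₁ : WeaklyFRegularModification)
    (h₂ : WeaklyFRegularResolution) :
    Summit.ResolutionOfSingularities.ResolutionOfSingularities.Theses.FrobeniusLadder.FRationalResolution := by
  intro p hp k _ _ X f hsep hft hqc hred hmodel
  exact h₂ p hp k X f hsep hft hqc hred (h₁ p hp k X f hsep hft hqc hred hmodel)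

/-- Sanity (card 2): a weakly F-regular model is in particular an F-rational model (every ideal ⊇
parameter ideals), so rung 4′ is implied by the crux and the split loses nothing logically. -/
theorem hasFRationalModel_of_hasWeaklyFRegularModel (p : ℕ) (X : AlgebraicGeometry.Scheme.{0})
    (h : HasWeaklyFRegularModel p X) : HasFRationalModel p X := by
  obtain ⟨X', π, hπ, hbir, hst⟩ := h
  refine ⟨X', π, hπ, hbir, fun x => ⟨(hst x).1, fun d _ s _ y c hc hy => ?_⟩⟩
  exact (hst x).2 (Ideal.span (Set.range s)) y c hc hy

/-! ## §3 Calibration object (negative note `suspension-calibration`) -/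

/-- The HYPERBOLIC SUSPENSION `Σf := k[x₁,…,x_n, y, z]/(y z + f)` of a polynomial `f` — the extended
Rees algebra (deformation to the normal cone) of the principal ideal `(f)`. The negative note shows:
`Σf` is strongly F-regular at the origin for EVERY `f ∈ (x) ∖ 0` (Fedder/Glassbrenner with test
element `y`), while `Sing Σ(f²) ≅ V(f)`; so every catalogued wild specimen re-enters the crux's
residual class two dimensions up. Variables: `Fin n` for `x`, then `y = X (inl ())`-style encoded as
`Option (Option (Fin n))` (`none` = `y`, `some none` = `z`, `some (some i)` = `x_i`). -/
noncomputable def hyperbolicSuspension (k : Type) [Field k] {n : ℕ} (f : MvPolynomial (Fin n) k) :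
    Type :=
  MvPolynomial (Option (Option (Fin n))) k ⧸
    Ideal.span {MvPolynomial.X none * MvPolynomial.X (some none) +
      MvPolynomial.rename (fun i => some (some i)) f}

end Summit.ResolutionOfSingularities.ResolutionOfSingularities.Cruxes.FRationalResolution.Sketch
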